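import Literature.NumberTheory.IwasawaTheory.ClassicalMuVanishesOddDiscrUnitDoorsTwoTrivialBase
import Literature.NumberTheory.IwasawaTheory.ZpExtensionLayerRamificationDichotomy
import Literature.NumberTheory.NumberFields.OneRamifiedPrimeTower
import Literature.NumberTheory.NumberFields.InertiaGeneratesGalois
import HarnessLib

/-!
# In a `ℤ_p`-tower with Fukuda index `0`, at most `#{v ∣ p}` primes of `K_n` ramify in `K_{n+1}` — the displayed hypothesis «at most `s`
# ramified primes in the layer» of the unit-norm-index doors, discharged from the base; the `p = 2` one-unit door from data of `K` and one unit

Topic `NumberTheory/IwasawaTheory` (namespace = path).  THEOREMS ONLY (no definition, no named fact, no instance, no `sorry`); unconditional.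
The unit-norm-index doors of the tree at a layer `K_{n+1}/K_n` (`ClassicalMuVanishesUnitNormIndexAnyPrime`, `…TwoNonNormUnits`,
`…OddDiscrUnitDoorsTwo`, and this seat's `hgen`-free `…TrivialBase` files) all carry the displayed hypothesis
`hs : #{w : prime of K_n ramified in K_{n+1}} ≤ s`.  For the FIRST layer the tree discharges it from the base
(`ncard_ramified_layer_le_of_ncard_eq`: the primes of `K` ramified in `K_1` lie above `p`).  This file discharges it at EVERY layer when
Fukuda's index is `0` (`TotallyRamifiedFrom κ 0`): a prime `w` of `K_n` ramified in `K_{n+1}` lies under a prime `𝔓` of `K_{n+1}` ramified over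
`K`, hence (dichotomy of brick (R), `ZpExtension.inertia_layer_eq_bot_or_forall_mem`) TOTALLY ramified over `K`; so `w = 𝔓 ∩ K_n` is totally ramified
over `v = w ∩ K` (`ramificationIdx_under_eq_finrank_bot`), it is the ONLY prime of `K_n` above `v` (`eq_of_under_eq_of_ramificationIdx_eq_finrank`),
and `v` lies above `p` (`ZpExtension.isUnramifiedIn_layer_of_not_mem`).  Hence `w ↦ w ∩ K` injects the ramified primes of the layer into the primes
of `K` above `p`.

* ★ `ncard_ramified_layer_succ_le` — `TotallyRamifiedFrom κ 0` ⟹ `#{w : prime of K_n ramified in K_{n+1}} ≤ #{v : prime of K above p}`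
  (every prime `p`, any compatible algebra structure `K_n → K_{n+1}`).
* `classNumberPExp_eq_of_le_of_pow_dvd_relIndex_mul_of_not_dvd_of_ncard_le` / `classicalMuVanishes_of_pow_dvd_relIndex_mul_of_not_dvd_of_ncard_le`
  (§3, every prime) — `p ∤ h_K`, `TotallyRamifiedFrom κ 0`, at most `s` primes of `K` above `p`, `p^s ∣ [E_{K_n} : E_{K_n} ∩ N K_{n+1}ˣ] · p` at ONE
  layer ⟹ `e_m = e_n` (`m ≥ n`), `μ = 0`, `λ = 0`;
* `classNumberPExp_eq_of_le_two_of_nonNorm_unit_of_ncard_le_two` / ★ `classicalMuVanishes_two_of_nonNorm_unit_of_ncard_le_two` — the `p = 2`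
  ONE-UNIT DOOR FROM DATA OF `K` AND ONE UNIT: `K` of odd degree, `2 ∤ d_K`, `2 ∤ h_K`, at most TWO primes above `2`, `κ` cyclotomic; a unit `x`
  of some layer `K_n` with `x ∉ N K_{n+1}ˣ` ⟹ `e_m = e_n` for all `m ≥ n`, `μ₂ = 0`, `λ₂ = 0`.

USE (cell bsd-f1-sign2, crux C2, W-free): `K = ℚ(β)` the cubic `2`-torsion field of a seed with `Δ_W ≡ 5 (mod 8)` (`2 = 𝔭₁𝔭₂`, `2 ∤ d_K`) and
`h(ℚ(β))` odd: every hypothesis is on `K` except the single unit of `K_n`, whose non-norm property is a kernel-decidable dyadic residue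
(`QuadraticNonNormUnitDyadicIdeal`).  HONEST SCOPE: classical; nothing specific to any summit; BSD is not advanced by this file.

## References

* L. C. Washington, *Introduction to Cyclotomic Fields*, 2nd ed., GTM 83 (1997), §13.1 Prop. 13.2, Lemma 13.3; §13.3 (standing assumption before
  Lemma 13.15: all primes ramified in `K_∞/K_n` are totally ramified). [Washington1997]
* J. Neukirch, *Algebraic Number Theory* (1999), Ch. I §9 (9.1), Prop. (9.6); Ch. II (9.6). [NeukirchANT1999]
* T. Fukuda, *Remarks on `ℤ_p`-extensions of number fields*, Proc. Japan Acad. 70 A (1994), p. 264 (the index `n₀`). [Fukuda1994]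
-/

noncomputable section

open NumberField IsDedekindDomain Field
open scoped nonZeroDivisors

namespace Literature.NumberTheory.IwasawaTheory

open Literature.NumberTheory.EllipticCurves Literature.NumberTheory.NumberFields
  Literature.NumberTheory.NumberFields.AmbiguousClass Literature.NumberTheory.NumberFields.ClassGroupNormKernel
  Literature.NumberTheory.GaloisRepresentations Literature.NumberTheory.GaloisRepresentations.Herbrand
  Literature.NumberTheory.GaloisRepresentations.MinkowskiUnit
  Literature.NumberTheory.GaloisRepresentations.CyclicNormIndex

/-! ## §1 The count, every prime -/

section Count

variable {K : Type} [Field K] [NumberField K] {p : ℕ} [hp : Fact p.Prime] (κ : ZpExtension K p) (n : ℕ)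
  [Algebra (κ.layer n) (κ.layer (n + 1))] [IsScalarTower K (κ.layer n) (κ.layer (n + 1))]

/-- ★ **At most `#{v ∣ p}` primes of `K_n` ramify in `K_{n+1}` when Fukuda's index is `0`.**  `κ` a `ℤ_p`-extension of `K` with
`TotallyRamifiedFrom κ 0`; `K_{n+1}` a `K_n`-algebra compatibly with `K`.  A prime `w` of `K_n` ramified in `K_{n+1}` lies under a prime `𝔓` of
`K_{n+1}` ramified — hence totally ramified — over `K`; so `w` is totally ramified over `v = w ∩ K`, is the only prime of `K_n` above `v`, and `v ∣ p`.
Thus `w ↦ w ∩ K` is injective on the ramified primes of the layer, with values among the primes of `K` above `p`.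
[cite: Washington1997, §13.1 Prop. 13.2 and §13.3 (before Lemma 13.15)] [cite: NeukirchANT1999, Ch. I §9 (9.1), Prop. (9.6)] -/
theorem ncard_ramified_layer_succ_le (hram : TotallyRamifiedFrom κ 0) [NumberField (κ.layer n)] [NumberField (κ.layer (n + 1))] :
    {w : HeightOneSpectrum (𝓞 (κ.layer n)) | w.asIdeal.ramificationIdxIn (𝓞 (κ.layer (n + 1))) ≠ 1}.ncard ≤
      {v : HeightOneSpectrum (𝓞 K) | ((p : ℕ) : 𝓞 K) ∈ v.asIdeal}.ncard := by
  classical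
  haveI : FiniteDimensional K (κ.layer n) := κ.finiteDimensional_layer_holds n
  haveI : FiniteDimensional K (κ.layer (n + 1)) := κ.finiteDimensional_layer_holds (n + 1)
  haveI : IsGalois K (κ.layer n) := κ.isGalois_layer_holds n
  haveI : IsGalois K (κ.layer (n + 1)) := κ.isGalois_layer_holds (n + 1)
  haveI : FiniteDimensional (κ.layer n) (κ.layer (n + 1)) := Module.Finite.of_restrictScalars_finite K _ _
  haveI : IsGalois (κ.layer n) (κ.layer (n + 1)) := isGalois_layer_layer κ
  have hpr : p.Prime := hp.out
  -- the primes above `p` form a finite set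
  have hp0 : Ideal.span {((p : ℕ) : 𝓞 K)} ≠ ⊥ := by
    rw [Ne, Ideal.span_singleton_eq_bot]
    exact_mod_cast hpr.ne_zero
  have hfin : {v : HeightOneSpectrum (𝓞 K) | ((p : ℕ) : 𝓞 K) ∈ v.asIdeal}.Finite := by
    refine (Ideal.finite_factors hp0).subset fun v hv => ?_
    exact (Ideal.dvd_span_singleton).mpr hv
  -- the restriction map `w ↦ w ∩ K`
  have hne : ∀ w : HeightOneSpectrum (𝓞 (κ.layer n)), w.asIdeal.under (𝓞 K) ≠ ⊥ := fun w =>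
    mt Ideal.eq_bot_of_comap_eq_bot w.ne_bot
  let f : HeightOneSpectrum (𝓞 (κ.layer n)) → HeightOneSpectrum (𝓞 K) := fun w =>
    ⟨w.asIdeal.under (𝓞 K), by haveI := w.isPrime; infer_instance, hne w⟩
  have hf : ∀ w, (f w).asIdeal = w.asIdeal.under (𝓞 K) := fun _ => rfl
  -- for a ramified `w`: a prime `𝔓 ∣ w` of `K_{n+1}` ramified over `K_n`
  have key : ∀ w : HeightOneSpectrum (𝓞 (κ.layer n)),
      w.asIdeal.ramificationIdxIn (𝓞 (κ.layer (n + 1))) ≠ 1 →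
        ((p : ℕ) : 𝓞 K) ∈ w.asIdeal.under (𝓞 K) ∧
          w.asIdeal.ramificationIdx (𝓞 K) = Module.finrank K (κ.layer n) := by
    intro w hw
    haveI : w.asIdeal.IsMaximal := w.isMaximal
    obtain ⟨𝔓, h𝔓max, h𝔓w⟩ := Ideal.exists_maximal_ideal_liesOver_of_isIntegral (S := 𝓞 (κ.layer (n + 1))) w.asIdeal
    haveI := h𝔓max
    haveI := h𝔓w
    have hPw : 𝔓.ramificationIdx (𝓞 (κ.layer n)) ≠ 1 := by
      rwa [Ideal.ramificationIdxIn_eq_ramificationIdx w.asIdeal 𝔓 ((κ.layer (n + 1)) ≃ₐ[κ.layer n] (κ.layer (n + 1)))]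
        at hw
    have htower := Ideal.ramificationIdx_tower (R := 𝓞 K) w.asIdeal 𝔓
    -- `𝔓` is ramified over `K`
    have hPK : 𝔓.ramificationIdx (𝓞 K) ≠ 1 := by
      rw [htower]
      exact fun h1 => hPw (Nat.eq_one_of_mul_eq_one_left h1)
    -- hence `v = w ∩ K` lies above `p`
    haveI : 𝔓.LiesOver (w.asIdeal.under (𝓞 K)) := Ideal.LiesOver.trans 𝔓 w.asIdeal (w.asIdeal.under (𝓞 K))
    have hv : ((p : ℕ) : 𝓞 K) ∈ w.asIdeal.under (𝓞 K) := by
      by_contra hpv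
      have hunr := κ.isUnramifiedIn_layer_of_not_mem (n + 1) (w := f w) hpv
      exact hPK (hunr.ramificationIdx_eq_one (𝔓 := 𝔓) inferInstance)
    -- and `𝔓` is totally ramified over `K` (dichotomy at Fukuda index `0`)
    have hI : 𝔓.inertia ((κ.layer (n + 1)) ≃ₐ[K] (κ.layer (n + 1))) = ⊤ := by
      rcases κ.inertia_layer_eq_bot_or_forall_mem hram (n := 0) (m := n + 1) le_rfl (Nat.zero_le _) 𝔓 with hbot | hall
      · exfalso
        apply hPK
        rw [← card_inertia_eq_ramificationIdx (κ.layer (n + 1)) ((κ.layer (n + 1)) ≃ₐ[K] (κ.layer (n + 1))) K 𝔓,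
          hbot, Subgroup.card_bot]
      · refine top_le_iff.mp fun g _ => hall g fun x hx => ?_
        rw [κ.layer_zero, IntermediateField.mem_bot] at hx
        obtain ⟨y, hy⟩ := hx
        have hxy : x = algebraMap K (κ.layer (n + 1)) y := Subtype.ext hy.symm
        rw [hxy, AlgEquiv.commutes]
    have he : 𝔓.ramificationIdx (𝓞 K) = Module.finrank K (κ.layer (n + 1)) := by
      rw [← card_inertia_eq_ramificationIdx (κ.layer (n + 1)) ((κ.layer (n + 1)) ≃ₐ[K] (κ.layer (n + 1))) K 𝔓, hI,
        Subgroup.card_top, IsGalois.card_aut_eq_finrank]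
    refine ⟨hv, ?_⟩
    have h := ramificationIdx_under_eq_finrank_bot (B := K) (F := κ.layer n) (F' := κ.layer (n + 1)) 𝔓 he
    rwa [← h𝔓w.over] at h
  refine Set.ncard_le_ncard_of_injOn f (fun w hw => ?_) (fun w₁ hw₁ w₂ hw₂ h12 => ?_) hfin
  · exact (key w hw).1
  · haveI : w₁.asIdeal.IsMaximal := w₁.isMaximal
    haveI : w₂.asIdeal.IsMaximal := w₂.isMaximal
    have hunder : w₂.asIdeal.under (𝓞 K) = w₁.asIdeal.under (𝓞 K) := by
      rw [← hf, ← hf, h12]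
    exact HeightOneSpectrum.ext
      (eq_of_under_eq_of_ramificationIdx_eq_finrank w₁.asIdeal (key w₁ hw₁).2 w₂.asIdeal hunder).symm

end Count

/-! ## §2 `p = 2`: the one-unit door from data of `K` and one unit of a layer -/

section Two

variable {K : Type} [Field K] [NumberField K] (κ : ZpExtension K 2) (n : ℕ) [NumberField (κ.layer n)]
  [Algebra (κ.layer n) (κ.layer (n + 1))] [IsScalarTower K (κ.layer n) (κ.layer (n + 1))]
  [FiniteDimensional K (κ.layer (n + 1))] [FiniteDimensional (κ.layer n) (κ.layer (n + 1))]

/-- **`e_m = e_n` for all `m ≥ n` from data of `K` and ONE unit.**  `K` of odd degree with `2 ∤ d_K`, `2 ∤ h_K` and at most TWO primes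
above `2`; `κ` a cyclotomic `ℤ₂`-extension; `x` a unit of `K_n` (inside `K_{n+1}ˣ`) with `x ∉ N K_{n+1}ˣ`.  The layer has at most two ramified
primes (`ncard_ramified_layer_succ_le`, Fukuda's index `0` by `totallyRamifiedFrom_zero_of_not_dvd_discr`); then
`classNumberPExp_eq_of_le_two_of_nonNorm_unit_of_not_dvd_discr_of_not_dvd`. [cite: Fukuda1994, Thm. 1 (1), p. 264]
[cite: Washington1997, §13.1 Prop. 13.2 and §13.3 Prop. 13.22] -/
theorem classNumberPExp_eq_of_le_two_of_nonNorm_unit_of_ncard_le_two (hK2 : ¬ 2 ∣ Module.finrank ℚ K)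
    (hd : ¬ (2 : ℤ) ∣ NumberField.discr K) (hK : ¬ 2 ∣ classNumber K)
    (h2 : {v : HeightOneSpectrum (𝓞 K) | ((2 : ℕ) : 𝓞 K) ∈ v.asIdeal}.ncard ≤ 2) (hκ : κ.IsCyclotomic)
    {x : (κ.layer (n + 1))ˣ} (hxE : x ∈ unitsE (κ.layer (n + 1)) ⊓ (unitsIncl (κ.layer n) (κ.layer (n + 1))).range)
    (hxN : x ∉ (⊤ : Subgroup (κ.layer (n + 1))ˣ).map
        (Herbrand.norm (κ.layer (n + 1) ≃ₐ[κ.layer n] κ.layer (n + 1))))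
    {m : ℕ} (hm : n ≤ m) : classNumberPExp κ m = classNumberPExp κ n := by
  haveI : NumberField (κ.layer (n + 1)) := NumberField.of_module_finite K (κ.layer (n + 1))
  exact classNumberPExp_eq_of_le_two_of_nonNorm_unit_of_not_dvd_discr_of_not_dvd κ n hK2 hd hK hκ
    ((ncard_ramified_layer_succ_le κ n (totallyRamifiedFrom_zero_of_not_dvd_discr hK2 hd κ hκ)).trans h2) hxE hxN hm

/-- ★ **`μ₂ = 0` (growth form) and `λ₂ = 0` from data of `K` and ONE unit.**  `K` of odd degree, `2 ∤ d_K`, `2 ∤ h_K`, at most two primes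
above `2`, `κ` cyclotomic, `x ∉ N K_{n+1}ˣ` a unit of `K_n`: `ClassicalMuVanishes κ ∧ classicalLambda κ = 0` — no class group and no prime
count of any layer `K_n`, `n ≥ 1`, is an input. [cite: Fukuda1994, Thm. 1 (1), p. 264] [cite: Washington1997, §13.1 Prop. 13.2 and §13.3 Prop. 13.22] -/
theorem classicalMuVanishes_two_of_nonNorm_unit_of_ncard_le_two (hK2 : ¬ 2 ∣ Module.finrank ℚ K)
    (hd : ¬ (2 : ℤ) ∣ NumberField.discr K) (hK : ¬ 2 ∣ classNumber K)
    (h2 : {v : HeightOneSpectrum (𝓞 K) | ((2 : ℕ) : 𝓞 K) ∈ v.asIdeal}.ncard ≤ 2) (hκ : κ.IsCyclotomic)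
    {x : (κ.layer (n + 1))ˣ} (hxE : x ∈ unitsE (κ.layer (n + 1)) ⊓ (unitsIncl (κ.layer n) (κ.layer (n + 1))).range)
    (hxN : x ∉ (⊤ : Subgroup (κ.layer (n + 1))ˣ).map
        (Herbrand.norm (κ.layer (n + 1) ≃ₐ[κ.layer n] κ.layer (n + 1)))) :
    ClassicalMuVanishes κ ∧ classicalLambda κ = 0 := by
  haveI : NumberField (κ.layer (n + 1)) := NumberField.of_module_finite K (κ.layer (n + 1))
  exact classicalMuVanishes_two_of_nonNorm_unit_of_not_dvd_discr_of_not_dvd κ n hK2 hd hK hκ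
    ((ncard_ramified_layer_succ_le κ n (totallyRamifiedFrom_zero_of_not_dvd_discr hK2 hd κ hκ)).trans h2) hxE hxN

end Two

/-! ## §3 Every prime: door UG without `hgen` from data of `K` and the unit norm index of one layer -/

section AnyPrime

variable {K : Type} [Field K] [NumberField K] {p : ℕ} [hp : Fact p.Prime] (κ : ZpExtension K p) (n : ℕ)
  [NumberField (κ.layer n)] [Algebra (κ.layer n) (κ.layer (n + 1))] [IsScalarTower K (κ.layer n) (κ.layer (n + 1))]
  [FiniteDimensional K (κ.layer (n + 1))] [FiniteDimensional (κ.layer n) (κ.layer (n + 1))]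

/-- **`e_m = e_n` for all `m ≥ n` from data of `K` and the unit norm index of ONE layer, every prime `p`.**  `κ` a `ℤ_p`-extension of `K`
with Fukuda's index `0` (`TotallyRamifiedFrom κ 0`) and `p ∤ h_K`; `K` with at most `s` primes above `p`; `K_{n+1}` a `K_n`-algebra compatibly
with `K` with `p^s ∣ [E_{K_n} : E_{K_n} ∩ N K_{n+1}ˣ] · p`.  Then the `p`-class numbers are constant from `K_n` on — the layer has at most `s`
ramified primes (`ncard_ramified_layer_succ_le`), then `classNumberPExp_eq_of_le_of_pow_dvd_relIndex_mul_of_not_dvd` (no generation hypothesis,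
no class group or prime count of any layer above `K`). [cite: Fukuda1994, Thm. 1 (1), p. 264] [cite: Lang1990, Ch. 13 §4, Lemma 4.1–4.2 and sequel]
[cite: Washington1997, §13.1 Prop. 13.2 and §13.3 Prop. 13.22] -/
theorem classNumberPExp_eq_of_le_of_pow_dvd_relIndex_mul_of_not_dvd_of_ncard_le (hram : TotallyRamifiedFrom κ 0)
    (hK : ¬ p ∣ classNumber K) {s : ℕ} (hsK : {v : HeightOneSpectrum (𝓞 K) | ((p : ℕ) : 𝓞 K) ∈ v.asIdeal}.ncard ≤ s)
    (hidx : p ^ s ∣ (unitsE (κ.layer (n + 1)) ⊓ (⊤ : Subgroup (κ.layer (n + 1))ˣ).map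
          (Herbrand.norm (κ.layer (n + 1) ≃ₐ[κ.layer n] κ.layer (n + 1)))).relIndex
        (unitsE (κ.layer (n + 1)) ⊓ (unitsIncl (κ.layer n) (κ.layer (n + 1))).range) * p)
    {m : ℕ} (hm : n ≤ m) : classNumberPExp κ m = classNumberPExp κ n := by
  haveI : NumberField (κ.layer (n + 1)) := NumberField.of_module_finite K (κ.layer (n + 1))
  exact classNumberPExp_eq_of_le_of_pow_dvd_relIndex_mul_of_not_dvd κ hram hK n (Nat.zero_le n)
    ((ncard_ramified_layer_succ_le κ n hram).trans hsK) hidx hm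

/-- **`μ = 0` (growth form) and `λ = 0` from data of `K` and the unit norm index of ONE layer, every prime `p`** (same hypotheses).
[cite: Fukuda1994, Thm. 1 (1), p. 264] [cite: Lang1990, Ch. 13 §4, Lemma 4.1–4.2 and sequel] -/
theorem classicalMuVanishes_of_pow_dvd_relIndex_mul_of_not_dvd_of_ncard_le (hram : TotallyRamifiedFrom κ 0)
    (hK : ¬ p ∣ classNumber K) {s : ℕ} (hsK : {v : HeightOneSpectrum (𝓞 K) | ((p : ℕ) : 𝓞 K) ∈ v.asIdeal}.ncard ≤ s)
    (hidx : p ^ s ∣ (unitsE (κ.layer (n + 1)) ⊓ (⊤ : Subgroup (κ.layer (n + 1))ˣ).map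
          (Herbrand.norm (κ.layer (n + 1) ≃ₐ[κ.layer n] κ.layer (n + 1)))).relIndex
        (unitsE (κ.layer (n + 1)) ⊓ (unitsIncl (κ.layer n) (κ.layer (n + 1))).range) * p) :
    ClassicalMuVanishes κ ∧ classicalLambda κ = 0 :=
  ⟨classicalMuVanishes_of_eventually_const κ (c := classNumberPExp κ n) (n₀ := n)
      fun _ hm => classNumberPExp_eq_of_le_of_pow_dvd_relIndex_mul_of_not_dvd_of_ncard_le κ n hram hK hsK hidx hm,
    classicalLambda_eq_zero_of_eventually_const κ (c := classNumberPExp κ n) (n₀ := n)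
      fun _ hm => classNumberPExp_eq_of_le_of_pow_dvd_relIndex_mul_of_not_dvd_of_ncard_le κ n hram hK hsK hidx hm⟩

end AnyPrime

end Literature.NumberTheory.IwasawaTheory

end
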